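import Summits.AtomisticToContinuum.BoseEinsteinCondensation.Theses.BECStronglyRayleigh
import Summits.AtomisticToContinuum.BoseEinsteinCondensation.Theses.BECPeriodicReduction
import Literature.Barriers.AtomisticToContinuum.KineticGapLengthScalesFreeGas
import Literature.Barriers.AtomisticToContinuum.KineticGapLengthScalesThermodynamicWindow

/-!
# Negative lemmas for crux `LatticeToPeriodicBridge` (stmt-AtomisticToContinuum-9674), I:
logic of the bridge, and every windowed bridge is equivalent to `¬ KineticLatticeBEC`

Supports stmt-AtomisticToContinuum-9674 (route `BECStronglyRayleigh`, rank 4): the crux is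
`KineticLatticeBEC → PeriodicBEC` (the consequent is stmt-0826's body verbatim, `crux_iff`).

* `not_crux_iff` — a disproof is exactly a proof of the lattice target `KineticLatticeBEC` plus a
  refutation of `PeriodicBEC`; `exists_badPotential_of_not_crux` — it must exhibit an admissible
  `v` whose torus ground states fail to condense at arbitrarily small density (`ConsequentAt v`
  false), and that `v` is not the free gas (`badPotential_ne_zero`, from
  `periodicBEC_antecedent_free`).
* `BridgeWindow w` — the NATURAL STRENGTHENING in which the consequent's existential slack `δ_N`
  is replaced by an explicit energy window `w ρ N` (what any energy-estimate-driven proof would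
  certify). `bridgeWindow_iff_not_kinetic`: for every super-gap window the windowed bridge holds
  iff the lattice target FAILS; instances `w = κN`, `κL_N²`, and density-dependent macroscopic
  windows `κ(ρ)N` (`densityWindow_superGap`, `not_densityWindow_at_thermodynamicBox`,
  `bridgeDensityWindow_iff_not_kinetic`) — the last covers Fournais's window
  `C₀aρ(ρa³)^{1/2-ε}N` at the thermodynamic box, for every admissible `v` individually.

No statement of the route is asserted; the two `def … : Prop` are the consequent's body at fixed
`v` and the windowed strengthening of the crux (both written over tree vocabulary). `[folklore]`
throughout (Galilei boosts + LSSY Lemma 4.1, as landed in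
`Literature/Barriers/AtomisticToContinuum/KineticGapLengthScales*`).
-/

noncomputable section

namespace Summit.AtomisticToContinuum.BoseEinsteinCondensation.Theorems.LatticeToPeriodicBridge.Negative

open Literature.MathematicalPhysics.QuantumManyBody.BoseGas
open Literature.Barriers.AtomisticToContinuum.BoseGas
open _root_.MeasureTheory _root_.Filter _root_.Topology
open scoped ENNReal NNReal

open Summit.AtomisticToContinuum.BoseEinsteinCondensation.Theses
open Summit.AtomisticToContinuum.BoseEinsteinCondensation.Theses.BECStronglyRayleigh

/-! ## Logic of the bridge -/

/-- The crux is literally `KineticLatticeBEC → PeriodicBEC`. [folklore] -/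
theorem crux_iff :
    LatticeToPeriodicBridge ↔ (KineticLatticeBEC → BECPeriodicReduction.PeriodicBEC) :=
  Iff.rfl

/-- **Negation normal form**: a disproof of the bridge is a proof of the lattice target together
with a refutation of periodic BEC. [folklore] -/
theorem not_crux_iff :
    ¬ LatticeToPeriodicBridge ↔ (KineticLatticeBEC ∧ ¬ BECPeriodicReduction.PeriodicBEC) := by
  rw [crux_iff]
  tauto

/-- The body of the consequent (stmt-0826) at a fixed potential `v`: torus ground-state BEC in the
constant mode at all small densities, read through near-minimisers. [folklore] -/
def ConsequentAt (v : ℝ → ℝ≥0∞) : Prop :=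
  ∃ ρ₀ : ℝ, 0 < ρ₀ ∧ ∀ ρ : ℝ, 0 < ρ → ρ < ρ₀ → ∃ c : ℝ, 0 < c ∧ ∀ᶠ N : ℕ in atTop,
    ∃ δ : ℝ≥0∞, 0 < δ ∧ ∀ Ψ : PeriodicTrialState N (sideLength ρ N),
      periodicEnergy v Ψ ≤ periodicGroundStateEnergy v N (sideLength ρ N) + δ →
        ENNReal.ofReal (c * N) ≤ condensateOccupation N (sideLength ρ N) Ψ.ψ

/-- `PeriodicBEC ↔ ∀ v admissible, ConsequentAt v`. [folklore] -/
theorem periodicBEC_iff :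
    BECPeriodicReduction.PeriodicBEC ↔ ∀ v, IsRepulsiveFiniteRange v → ConsequentAt v :=
  Iff.rfl

/-- The consequent holds for the free gas (`periodicBEC_antecedent_free`). [folklore] -/
theorem consequentAt_zero : ConsequentAt 0 :=
  periodicBEC_antecedent_free

/-- **What a kill needs on the continuum side**: an admissible potential whose torus ground states
fail to condense at arbitrarily small density … [folklore] -/
theorem exists_badPotential_of_not_crux (h : ¬ LatticeToPeriodicBridge) :
    ∃ v : ℝ → ℝ≥0∞, IsRepulsiveFiniteRange v ∧ ¬ ConsequentAt v := by
  have h' := (not_crux_iff.1 h).2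
  rw [periodicBEC_iff] at h'
  push Not at h'
  exact h'

/-- … and it is not the free gas. [folklore] -/
theorem badPotential_ne_zero {v : ℝ → ℝ≥0∞} (h : ¬ ConsequentAt v) : v ≠ 0 := by
  rintro rfl
  exact h consequentAt_zero

/-! ## Every windowed bridge is equivalent to `¬ KineticLatticeBEC` -/

/-- The bridge with a WINDOWED consequent: the existential slack `δ_N` of stmt-0826 replaced by an
explicit energy window `w ρ N` (a natural strengthening of the crux when `w > 0`). [folklore] -/
def BridgeWindow (w : ℝ → ℕ → ℝ≥0∞) : Prop :=
  KineticLatticeBEC →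
    ∀ v : ℝ → ℝ≥0∞, IsRepulsiveFiniteRange v → ∃ ρ₀ : ℝ, 0 < ρ₀ ∧ ∀ ρ : ℝ, 0 < ρ → ρ < ρ₀ →
      ∃ c : ℝ, 0 < c ∧ ∀ᶠ N : ℕ in atTop, ∀ Ψ : PeriodicTrialState N (sideLength ρ N),
        periodicEnergy v Ψ ≤ periodicGroundStateEnergy v N (sideLength ρ N) + w ρ N →
          ENNReal.ofReal (c * N) ≤ condensateOccupation N (sideLength ρ N) Ψ.ψ

/-- **Windowed bridge ↔ ¬(lattice target)** for every super-gap window (Galilei boosts,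
`not_periodicBEC_window`, witness `v = 0`). [folklore] -/
theorem bridgeWindow_iff_not_kinetic {w : ℝ → ℕ → ℝ≥0∞}
    (hw : ∀ ρ : ℝ, 0 < ρ → ∀ M : ℕ, ∀ᶠ N : ℕ in atTop,
      ENNReal.ofReal (4 * Real.pi ^ 2 * M ^ 2 / sideLength ρ N ^ 2 * N) < w ρ N) :
    BridgeWindow w ↔ ¬ KineticLatticeBEC :=
  ⟨fun h hA => not_periodicBEC_window hw (h hA), fun h hA => absurd hA h⟩

/-- The lattice target refutes every macroscopic-window bridge (`w = κN`). [folklore] -/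
theorem not_bridgeMacroscopicWindow_of_kinetic (hA : KineticLatticeBEC) {κ : ℝ} (hκ : 0 < κ) :
    ¬ BridgeWindow (fun _ N => ENNReal.ofReal (κ * N)) :=
  fun h => not_periodicBEC_macroscopicWindow hκ (h hA)

/-- … and every surface-window bridge (`w = κL_N²`). [folklore] -/
theorem not_bridgeSurfaceWindow_of_kinetic (hA : KineticLatticeBEC) {κ : ℝ} (hκ : 0 < κ) :
    ¬ BridgeWindow (fun ρ N => ENNReal.ofReal (κ * sideLength ρ N ^ 2)) :=
  fun h => not_periodicBEC_surfaceWindow hκ (h hA)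

/-- Density-dependent macroscopic windows `κ(ρ)N`, `κ(ρ) > 0`, are super-gap along the
thermodynamic box (Fournais's (1.8) has `κ(ρ) = C₀aρ(ρa³)^{1/2-ε}`). [folklore] -/
theorem densityWindow_superGap {κ : ℝ → ℝ} (hκ : ∀ ρ : ℝ, 0 < ρ → 0 < κ ρ) :
    ∀ ρ : ℝ, 0 < ρ → ∀ M : ℕ, ∀ᶠ N : ℕ in atTop,
      ENNReal.ofReal (4 * Real.pi ^ 2 * M ^ 2 / sideLength ρ N ^ 2 * N) <
        ENNReal.ofReal (κ ρ * N) := by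
  intro ρ hρ M
  refine eventually_gap_lt hρ M ?_
  have h2 : Tendsto (fun N : ℕ => κ ρ * ρ * sideLength ρ N ^ 2) atTop atTop :=
    ((tendsto_pow_atTop two_ne_zero).comp (tendsto_sideLength_atTop hρ)).const_mul_atTop
      (mul_pos (hκ ρ hρ) hρ)
  refine (tendsto_congr' ?_).mpr h2
  filter_upwards [eventually_gt_atTop 0] with N hN
  have hL : 0 < sideLength ρ N := sideLength_pos_of_pos hρ hN
  rw [natCast_eq_mul_sideLength_pow_three hρ hN]
  field_simp

/-- **No Fournais-type statement at the thermodynamic box**, for every admissible `v`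
individually and every density-dependent macroscopic window `κ(ρ)N`. (Fournais 2020 Thm 1.2,
`Fournais2020_condensation_holds`, lives on boxes `C_L(ρa³)^{-δ}(ρa)^{-1/2}`, not on
`L_N = (N/ρ)^{1/3}`.) [folklore] -/
theorem not_densityWindow_at_thermodynamicBox {v : ℝ → ℝ≥0∞} (hv : IsRepulsiveFiniteRange v)
    {κ : ℝ → ℝ} (hκ : ∀ ρ : ℝ, 0 < ρ → 0 < κ ρ) :
    ¬ (∃ ρ₀ : ℝ, 0 < ρ₀ ∧ ∀ ρ : ℝ, 0 < ρ → ρ < ρ₀ →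
        ∃ c : ℝ, 0 < c ∧ ∀ᶠ N : ℕ in atTop, ∀ Ψ : PeriodicTrialState N (sideLength ρ N),
          periodicEnergy v Ψ ≤
              periodicGroundStateEnergy v N (sideLength ρ N) + ENNReal.ofReal (κ ρ * N) →
            ENNReal.ofReal (c * N) ≤ condensateOccupation N (sideLength ρ N) Ψ.ψ) :=
  not_periodicBEC_window_pointwise hv (w := fun ρ N => ENNReal.ofReal (κ ρ * N))
    (densityWindow_superGap hκ)

/-- **Density-window bridge ↔ ¬(lattice target)**. [folklore] -/
theorem bridgeDensityWindow_iff_not_kinetic {κ : ℝ → ℝ} (hκ : ∀ ρ : ℝ, 0 < ρ → 0 < κ ρ) :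
    BridgeWindow (fun ρ N => ENNReal.ofReal (κ ρ * N)) ↔ ¬ KineticLatticeBEC :=
  bridgeWindow_iff_not_kinetic (densityWindow_superGap hκ)

end Summit.AtomisticToContinuum.BoseEinsteinCondensation.Theorems.LatticeToPeriodicBridge.Negative

end
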